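import Summits.ResolutionOfSingularities.ResolutionOfSingularities.Theorems.FrobeniusLadderFRationalResolutionChartAlgebraOrthantPoints
import Summits.ResolutionOfSingularities.ResolutionOfSingularities.Theorems.FrobeniusLadderFRationalResolutionChartAlgebraFixedPointEmbdim
import Summits.ResolutionOfSingularities.ResolutionOfSingularities.Theorems.FrobeniusLadderFRationalResolutionVertexChartFaces
import Summits.ResolutionOfSingularities.ResolutionOfSingularities.Theorems.FrobeniusLadderFRationalResolutionAdaptedBasisOrthant
import HarnessLib

/-!
# Crux `FrobeniusLadder.FRationalResolution` (stmt-ResolutionOfSingularities-15317), line `redirect`,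
# stub `stub_diagonalizableQuotientResolution` — **the points of a rank-two vertex chart algebra over a
# surface point: regular off the fixed point, singular at it when `c ≥ 2`** (point-blow-up recursion
# for the surface case over arbitrary fields, memo MEMO-15317-leafhand2-g6 §3–§4: the per-chart
# dichotomy, assembled from `…ChartAlgebraOrthantPoints`, `…ChartAlgebraFixedPointEmbdim`,
# `…ChartAlgebraFixedPointDim`, `…VertexChartMonoid`, `…VertexChartFaces`, `…AdaptedBasisOrthant`)

Let `φ : P → A` be an fs spanning chart on a Noetherian ring, log regular at the prime `𝔭` with unit-face
group `L = ℤF_𝔭`, and `C = A[χ(Q)]` a chart algebra over it ((χ), (gen), (D), (K), (Ω)) whose monoid is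
a VERTEX CHART MONOID `Q = L + {m v + l x : m ≥ 0, m + c l ≥ 0}` (`(v, x)` independent modulo `L`,
`L + ℤv + ℤx = ℤⁿ`; `y = c v − x`). For a prime `𝔓` of `C` over `𝔭`:

* **`isRegularLocalRing_of_generator_not_mem`** — if one of `χ(v), χ(x), χ(y)` is NOT in `𝔓` (equivalently,
  by `…VertexChartFaces.face_contains_generator`, `𝔓` is not the torus-fixed point), then `C_𝔓` is a
  regular local ring: the localised monoid `Q⟨−v⟩`, `Q⟨−x⟩` or `Q⟨−y⟩` is orthant-like
  (`…VertexChartFaces`, `…AdaptedBasisOrthant`) and Kato (10.3) applies one prime at a time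
  (`…ChartAlgebraOrthantPoints`);
* **`not_isRegularLocalRing_fixedPrime_of_two_le`** — if `c ≥ 2`, `𝔓` IS the fixed point (contains
  `χ(Q ∖ L)`), the stratum of `𝔭` is a point and `dim A_𝔭 ≤ 2`, then `C_𝔓` is NOT regular: the three
  irreducible monomials `v, x, y` give three independent cotangent vectors (`…VertexChartMonoid.vertex_irr`,
  `…ChartAlgebraFixedPointEmbdim`) while `dim C_𝔓 ≤ dim A_𝔭 ≤ 2` (`…ChartAlgebraFixedPointDim`).

So on such a chart over a surface point the singular locus over `𝔭` is exactly the fixed point when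
`c ≥ 2` (and, with `…VertexChartBlowup`, blowing it up produces a vertex chart with parameter `c − 2` and
two free charts). Honest label: assembly toward ONE leaf stub (no stub, crux or summit closed). No
definitions, no named facts, no sorry. [cite: Kato1994, (10.1), (10.3)] [cite: Niziol2006, §4]
-/

noncomputable section

-- single-problem summit: the doubled namespace component is forced
set_option linter.dupNamespace false

open IsLocalRing Literature.AlgebraicGeometry.Resolution Literature.AlgebraicGeometry.Resolution.LogChart
  Literature.AlgebraicGeometry.Resolution.LogRefinedChart
open Summit.ResolutionOfSingularities.ResolutionOfSingularities.Theorems.FRationalResolution.ChartAlgebraOrthantPoints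
open Summit.ResolutionOfSingularities.ResolutionOfSingularities.Theorems.FRationalResolution.ChartAlgebraFixedPointDim
open Summit.ResolutionOfSingularities.ResolutionOfSingularities.Theorems.FRationalResolution.ChartAlgebraFixedPointEmbdim
open Summit.ResolutionOfSingularities.ResolutionOfSingularities.Theorems.FRationalResolution.VertexChartMonoid
open Summit.ResolutionOfSingularities.ResolutionOfSingularities.Theorems.FRationalResolution.VertexChartFaces
open Summit.ResolutionOfSingularities.ResolutionOfSingularities.Theorems.FRationalResolution.AdaptedBasisOrthant

namespace Summit.ResolutionOfSingularities.ResolutionOfSingularities.Theorems.FRationalResolution.VertexChartRegularity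

universe u

variable {A : Type u} [CommRing A] [IsNoetherianRing A] {n : ℕ} {P : AddSubmonoid (Fin n → ℤ)}
  {φ : Multiplicative P →* A} {𝔭 : Ideal A} [𝔭.IsPrime] {C : Type u} [CommRing C] [Algebra A C]
  {Q : AddSubmonoid (Fin n → ℤ)} {χ : Multiplicative Q →* C} {v x : Fin n → ℤ} {c : ℕ}

omit [IsNoetherianRing A] in
/-- The symmetric data `(v, y)`: every vector also has coordinates in `(v, y)`. [folklore] -/
theorem span_symm (hspan : ∀ w : Fin n → ℤ, ∃ g ∈ Submodule.span ℤ (faceMonoid P φ 𝔭 : Set (Fin n → ℤ)),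
      ∃ m l : ℤ, w = g + m • v + l • x) :
    ∀ w : Fin n → ℤ, ∃ g ∈ Submodule.span ℤ (faceMonoid P φ 𝔭 : Set (Fin n → ℤ)), ∃ m l : ℤ,
      w = g + m • v + l • ((c : ℤ) • v - x) := by
  intro w
  obtain ⟨g, hg, m, l, rfl⟩ := hspan w
  exact ⟨g, hg, m + (c : ℤ) * l, -l, by module⟩

/-- **Off the fixed point the vertex chart algebra is regular.** If one of `χ(v)`, `χ(x)`, `χ(y)` is a
unit at the prime `𝔓` of `C` (with `φ` log regular at `𝔓 ∩ A = 𝔭`), then `C_𝔓` is a regular local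
ring. [cite: Kato1994, (10.1), (10.3)] -/
theorem isRegularLocalRing_of_generator_not_mem (hP : P.FG)
    (hsat : ∀ (w : Fin n → ℤ) (k : ℕ), 0 < k → k • w ∈ P → w ∈ P)
    (hspanP : Submodule.span ℤ (P : Set (Fin n → ℤ)) = ⊤) (hPQ : P ≤ Q)
    (hχ : ∀ p : P, χ (Multiplicative.ofAdd ⟨(p : Fin n → ℤ), hPQ p.2⟩) =
      algebraMap A C (φ (Multiplicative.ofAdd p)))
    (hgen : Algebra.adjoin A (Set.range χ) = ⊤)
    (hΩ : ∀ (K : Type u) [Field K] (g : A →+* K), (∀ p : P, g (φ (Multiplicative.ofAdd p)) ≠ 0) →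
      ∃ ω : C →+* K, ω.comp (algebraMap A C) = g)
    (hD : ∀ q ∈ Q, ∃ p ∈ P, q + p ∈ P)
    (hQ : ∀ w, w ∈ Q ↔ ∃ g ∈ Submodule.span ℤ (faceMonoid P φ 𝔭 : Set (Fin n → ℤ)), ∃ m l : ℤ,
      0 ≤ m ∧ 0 ≤ m + (c : ℤ) * l ∧ w = g + m • v + l • x)
    (hind : ∀ g ∈ Submodule.span ℤ (faceMonoid P φ 𝔭 : Set (Fin n → ℤ)), ∀ m l : ℤ,
      g + m • v + l • x = 0 → m = 0 ∧ l = 0)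
    (hspan : ∀ w : Fin n → ℤ, ∃ g ∈ Submodule.span ℤ (faceMonoid P φ 𝔭 : Set (Fin n → ℤ)),
      ∃ m l : ℤ, w = g + m • v + l • x)
    (𝔓 : Ideal C) [𝔓.IsPrime] (h𝔓 : 𝔓.comap (algebraMap A C) = 𝔭) (hreg : IsLogRegularAt P φ 𝔭)
    (hv : v ∈ Q) (hx : x ∈ Q) (hy : (c : ℤ) • v - x ∈ Q)
    (hunit : χ (Multiplicative.ofAdd ⟨v, hv⟩) ∉ 𝔓 ∨ χ (Multiplicative.ofAdd ⟨x, hx⟩) ∉ 𝔓 ∨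
      χ (Multiplicative.ofAdd ⟨(c : ℤ) • v - x, hy⟩) ∉ 𝔓) :
    IsRegularLocalRing (Localization.AtPrime 𝔓) := by
  have hreg' : IsLogRegularAt P φ (𝔓.comap (algebraMap A C)) := by
    have key : ∀ (𝔮 : Ideal A) [𝔮.IsPrime], 𝔮 = 𝔭 → IsLogRegularAt P φ 𝔮 := by
      intro 𝔮 _ h; subst h; exact hreg
    exact key _ h𝔓
  rcases hunit with hgv | hgx | hgy
  · -- `Q⟨−v⟩ = L + ℤv + ℤx`
    obtain ⟨b, I, hI⟩ := exists_isOrthantLike_of_mem_iff (Q := awayMonoid Q ⟨v, hv⟩) hind hspan ∅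
      (fun w => by
        rw [mem_awayMonoid_v_iff hQ hspan hv w]
        constructor
        · rintro ⟨g, hg, m, l, h⟩; exact ⟨g, hg, m, l, by simp, by simp, h⟩
        · rintro ⟨g, hg, m, l, -, -, h⟩; exact ⟨g, hg, m, l, h⟩)
    exact isRegularLocalRing_localization_of_isOrthantLike_awayMonoid hP hsat hspanP hPQ hχ hgen hΩ hD 𝔓
      hreg' ⟨v, hv⟩ hgv hI
  · -- `Q⟨−x⟩ = L + ℕv + ℤx`
    obtain ⟨b, I, hI⟩ := exists_isOrthantLike_of_mem_iff (Q := awayMonoid Q ⟨x, hx⟩) hind hspan {0}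
      (fun w => by
        rw [mem_awayMonoid_x_iff hQ hind hspan hx w]
        constructor
        · rintro ⟨g, hg, m, l, hm, h⟩; exact ⟨g, hg, m, l, fun _ => hm, by simp, h⟩
        · rintro ⟨g, hg, m, l, hm, -, h⟩; exact ⟨g, hg, m, l, hm (by simp), h⟩)
    exact isRegularLocalRing_localization_of_isOrthantLike_awayMonoid hP hsat hspanP hPQ hχ hgen hΩ hD 𝔓
      hreg' ⟨x, hx⟩ hgx hI
  · -- `Q⟨−y⟩ = L + ℕv + ℤy`, by the symmetry `x ↔ y`
    obtain ⟨hQ', hind'⟩ := vertex_symm hQ hind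
    have hspan' := span_symm (c := c) hspan
    obtain ⟨b, I, hI⟩ := exists_isOrthantLike_of_mem_iff (Q := awayMonoid Q ⟨(c : ℤ) • v - x, hy⟩)
      hind' hspan' {0}
      (fun w => by
        rw [mem_awayMonoid_x_iff hQ' hind' hspan' hy w]
        constructor
        · rintro ⟨g, hg, m, l, hm, h⟩; exact ⟨g, hg, m, l, fun _ => hm, by simp, h⟩
        · rintro ⟨g, hg, m, l, hm, -, h⟩; exact ⟨g, hg, m, l, hm (by simp), h⟩)
    exact isRegularLocalRing_localization_of_isOrthantLike_awayMonoid hP hsat hspanP hPQ hχ hgen hΩ hD 𝔓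
      hreg' ⟨_, hy⟩ hgy hI

/-- **At the fixed point the vertex chart algebra is singular (for `c ≥ 2`, over a surface point).** If
`c ≥ 2`, `𝔓` is a prime of `C` over `𝔭` containing `χ(Q ∖ L)`, the stratum of `𝔭` is a point
(`𝔪_{A_𝔭} = I(𝔭, φ)A_𝔭`) and `dim A_𝔭 ≤ 2`, then `C_𝔓` is not a regular local ring (three independent
cotangent vectors `χ(v), χ(x), χ(y)` against `dim C_𝔓 ≤ 2`). [cite: Kato1994, (6.1), (10.1)] -/
theorem not_isRegularLocalRing_fixedPrime_of_two_le [IsNoetherianRing C] (hc : 2 ≤ c) (hP : P.FG)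
    (hsat : ∀ (w : Fin n → ℤ) (k : ℕ), 0 < k → k • w ∈ P → w ∈ P) (hreg : IsLogRegularAt P φ 𝔭)
    (hPQ : P ≤ Q)
    (hχ : ∀ p : P, χ (Multiplicative.ofAdd ⟨(p : Fin n → ℤ), hPQ p.2⟩) =
      algebraMap A C (φ (Multiplicative.ofAdd p)))
    (hgen : Algebra.adjoin A (Set.range χ) = ⊤)
    (hD : ∀ q ∈ Q, ∃ p ∈ P, q + p ∈ P)
    (hK : ∀ a : A, algebraMap A C a = 0 → ∃ p : P, φ (Multiplicative.ofAdd p) * a = 0)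
    (hQfg : Q.FG)
    (hQ : ∀ w, w ∈ Q ↔ ∃ g ∈ Submodule.span ℤ (faceMonoid P φ 𝔭 : Set (Fin n → ℤ)), ∃ m l : ℤ,
      0 ≤ m ∧ 0 ≤ m + (c : ℤ) * l ∧ w = g + m • v + l • x)
    (hind : ∀ g ∈ Submodule.span ℤ (faceMonoid P φ 𝔭 : Set (Fin n → ℤ)), ∀ m l : ℤ,
      g + m • v + l • x = 0 → m = 0 ∧ l = 0)
    (hspan : ∀ w : Fin n → ℤ, ∃ g ∈ Submodule.span ℤ (faceMonoid P φ 𝔭 : Set (Fin n → ℤ)),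
      ∃ m l : ℤ, w = g + m • v + l • x)
    {𝔓 : Ideal C} [𝔓.IsPrime] (h𝔓 : 𝔓.comap (algebraMap A C) = 𝔭)
    (hq : ∀ q : Q, (q : Fin n → ℤ) ∉ Submodule.span ℤ (faceMonoid P φ 𝔭 : Set (Fin n → ℤ)) →
      χ (Multiplicative.ofAdd q) ∈ 𝔓)
    (h0 : maximalIdeal (Localization.AtPrime 𝔭) ≤
      (ideal P φ 𝔭).map (algebraMap A (Localization.AtPrime 𝔭)))
    (hdimA : ringKrullDim (Localization.AtPrime 𝔭) ≤ (2 : ℕ)) :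
    ¬ IsRegularLocalRing (Localization.AtPrime 𝔓) := by
  classical
  have hS := vertex_face (by omega : 1 ≤ c) hQ hind
  obtain ⟨⟨hvQ, hvL⟩, ⟨hxQ, hxL⟩, ⟨hyQ, hyL⟩⟩ := vertex_gens_mem hQ hind
  -- the three monomials, as a finset of `Q`
  let ev : Q := ⟨v, hvQ⟩
  let ex : Q := ⟨x, hxQ⟩
  let ey : Q := ⟨(c : ℤ) • v - x, hyQ⟩
  -- coordinates of the three monomials
  have cv : (ev : Fin n → ℤ) = (1 : ℤ) • v + (0 : ℤ) • x := by simp [ev]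
  have cx : (ex : Fin n → ℤ) = (0 : ℤ) • v + (1 : ℤ) • x := by simp [ex]
  have cy : (ey : Fin n → ℤ) = (c : ℤ) • v + (-1 : ℤ) • x := by simp [ey, sub_eq_add_neg]
  -- distinctness
  have hne : ∀ {m₁ l₁ m₂ l₂ : ℤ} {e₁ e₂ : Q}, (e₁ : Fin n → ℤ) = m₁ • v + l₁ • x →
      (e₂ : Fin n → ℤ) = m₂ • v + l₂ • x → (m₁, l₁) ≠ (m₂, l₂) → e₁ ≠ e₂ := by
    intro m₁ l₁ m₂ l₂ e₁ e₂ h1 h2 hne heq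
    apply hne
    have h3 : (0 : Fin n → ℤ) + (m₁ - m₂) • v + (l₁ - l₂) • x = 0 := by
      rw [show (0 : Fin n → ℤ) + (m₁ - m₂) • v + (l₁ - l₂) • x = (m₁ • v + l₁ • x) - (m₂ • v + l₂ • x) by
        module, ← h1, ← h2, heq, sub_self]
    obtain ⟨h4, h5⟩ := hind 0 (Submodule.zero_mem _) _ _ h3
    rw [Prod.mk.injEq]; omega
  have hvx : ev ≠ ex := hne cv cx (by simp)
  have hvy : ev ≠ ey := hne cv cy (by simp)
  have hxy : ex ≠ ey := hne cx cy (by simp)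
  let H : Finset Q := {ev, ex, ey}
  have hcard : H.card = 3 := by
    simp only [H]
    rw [Finset.card_insert_of_notMem, Finset.card_insert_of_notMem, Finset.card_singleton]
    · simpa using hxy
    · simp only [Finset.mem_insert, Finset.mem_singleton, not_or]; exact ⟨hvx, hvy⟩
  -- membership in `H` gives coordinates among `(1,0), (0,1), (c,−1)`
  have hcoord : ∀ h ∈ H, ∃ m l : ℤ, ((m = 1 ∧ l = 0) ∨ (m = 0 ∧ l = 1) ∨ (m = c ∧ l = -1)) ∧
      (h : Fin n → ℤ) = m • v + l • x := by
    intro h hh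
    simp only [H, Finset.mem_insert, Finset.mem_singleton] at hh
    rcases hh with rfl | rfl | rfl
    · exact ⟨1, 0, Or.inl ⟨rfl, rfl⟩, cv⟩
    · exact ⟨0, 1, Or.inr (Or.inl ⟨rfl, rfl⟩), cx⟩
    · exact ⟨c, -1, Or.inr (Or.inr ⟨rfl, rfl⟩), cy⟩
  refine not_isRegularLocalRing_fixedPrime hP hsat hreg hPQ hχ hgen hD hK hS h𝔓 hq h0 H ?_ ?_ ?_ ?_
  · -- `H ⊆ Q ∖ L`
    intro h hh
    obtain ⟨m, l, hml, hh'⟩ := hcoord h hh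
    rw [hh', show m • v + l • x = 0 + m • v + l • x by rw [zero_add], mem_L_iff hind (Submodule.zero_mem _)]
    omega
  · -- `hirr₁`
    intro h hh h' hh' hne' s
    obtain ⟨m₁, l₁, hml₁, e₁⟩ := hcoord h hh
    obtain ⟨m₂, l₂, hml₂, e₂⟩ := hcoord h' hh'
    have hpair : (m₁, l₁) ≠ (m₂, l₂) := by
      intro heq
      apply hne'
      apply Subtype.ext
      rw [e₁, e₂]
      obtain ⟨rfl, rfl⟩ := Prod.mk.inj heq
      rfl
    rw [e₁, e₂]
    exact vertex_irr₁ hc hQ hind hml₁ hml₂ hpair s s.2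
  · -- `hirr₂`
    intro h hh q₁ hq₁ q₂ hq₂ hq₁L hq₂L s
    obtain ⟨m₀, l₀, hml₀, e₀⟩ := hcoord h hh
    rw [e₀]
    exact vertex_irr₂ hc hQ hind hml₀ q₁ hq₁ q₂ hq₂ hq₁L hq₂L s s.2
  · -- `dim C_𝔓 ≤ dim A_𝔭 ≤ 2 < 3`
    rw [hcard]
    have h1 := ringKrullDim_le_of_fixedPrime hQfg (vertex_saturated hQ hind hspan) hPQ hχ hgen hS hreg h𝔓 hq
    refine lt_of_le_of_lt (h1.trans hdimA) ?_
    exact_mod_cast (by norm_num : (2 : ℕ) < 3)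

end Summit.ResolutionOfSingularities.ResolutionOfSingularities.Theorems.FRationalResolution.VertexChartRegularity

end
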